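import Summits.AtomisticToContinuum.FouriersLaw.Theorems.BondHeatUncertaintyExtensiveSnapshotIrreversibilityEnergyWindowHarmonicSkeleton
import HarnessLib

/-!
# Bond–heat uncertainty window, part U-d2: the HARMONIC CALIBRATION of (SWM)

Cell `decomp-a2c`, lineage crux `ExtensiveSnapshotIrreversibility` (K_fix half, leaf S3
`KernelTemperatureLipschitz`).  Critic rows 1093 (g) / 1107 (e): before any (SWM)-type claim the
harmonic chain (`lam = β = 0`) must be decided BY HAND in the exact (SWM)-clause shape, with the
rate `s^{-b₀}`, `b₀ = 1/2`.  This file does that — `harmonic_swmBody` proves the body of (SWM)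
(part R `SkeletonWeightMoments`, restated NOWHERE: `skeletonWeightMoments_iff` is `Iff.rfl`) at
`lam = β = 0` with `b₀ = 1/2`, `δ₀ = T`, for EVERY `q > 0`, uniformly in `κ > 0`, eventually in the
level `m ≥ m₁(κ)`.

* §3 the costate sampling bound of part U-e, `aᵀΓ_m a ≥ 2γT_b (½∫₀ˢβ_λ² − 2^{-m}E(λ))`, the
  sampling RATE (part U-d1 §1: arrival pivot `λ_{p_b} = a·e_b`, departure pivot `β_λ(0) = a·V`),
  `E(λ) ≤ c₀‖λ‖² ≤ c₀|a|²` and `pivot_bound` give `2^{-m}Σ_j U_j² = aᵀΓ_m a ≤ 4K/(2γT_b s)` once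
  `2γT_b c₀ 2^{-m} ≤ κ`, i.e. for `m ≥ m₁(κ)`;
* §4 assembly: `‖w_{m,κ}‖_{L^q} ≤ C s^{-1/2}`, `C = (E|Z|^q)^{1/q} (4K/(γT))^{1/2}`, both clauses,
  both baths (`T_b ∈ [T/2, 3T/2]` for `|δ| < T`); `SWMBody`, `skeletonWeightMoments_iff`
  (`Iff.rfl`),
  `harmonic_swmBody`.
The bound is an UPPER bound, which is what (SWM) asserts; the value `b₀ = 1/2` calibrates the
exponents of (G1*ᶜᶜ)/(G1ℓ).  No new instance / notation; no proof holes.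
References: Nualart (2006) §1.3, §2.3; Coron, *Control and Nonlinearity* (2007), §1.2.
[folklore]
-/

noncomputable section

namespace Summit.AtomisticToContinuum.FouriersLaw.Theorems.ExtensiveSnapshotIrreversibility.EnergyWindow

open MeasureTheory ProbabilityTheory Filter Topology Set NormedSpace
open scoped ENNReal NNReal Matrix
open Literature.MathematicalPhysics.KineticTheory.HeatConduction
open Literature.Probability.Process Literature.Analysis.ODE

section Harmonic

variable {ω₂ γ : ℝ} (hω : 0 < ω₂) (hγ : 0 < γ) (N : ℕ) (T_L T_R : ℝ)

include hω hγ

/-! ## 3. The Gram form of the regularised controls is `O(1/s)` -/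

/-- **Left bath**: the costate sampling lower bound of part U-e at `(z, r, x) = (0, 0, 0)`, as a
bound for `2^{-m} Σ_j (a ᵥ* J)_j²` (the `inl`-cells alone). [folklore] -/
theorem harmonic_gramForm_ge_left (hN : 2 ≤ N) {s : ℝ} (hs0 : 0 < s) (hs1 : s ≤ 1) (m : ℕ)
    (a : Fin N ⊕ Fin N → ℝ) :
    ampL ω₂ 0 0 γ T_L ^ 2 * ((1 / 2) * (∫ t in (0 : ℝ)..s,
        ((harmCostate ω₂ γ N s (ofCoordV N a) t).2 (leftBath N hN)) ^ 2) -
          ((2 : ℝ) ^ m)⁻¹ * harmGramErr ω₂ γ N s (ofCoordV N a)) ≤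
      ((2 : ℝ) ^ m)⁻¹ * ∑ j, ((a ᵥ* skelJacAt ω₂ 0 0 γ N T_L T_R s m 0 0 0) j) ^ 2 := by
  have hN' : 0 < N := by omega
  have h := harmonic_skelGramForm_ge_inl hω hγ.le hN' T_L T_R m 0 0 0 hs0 hs1 (ofCoordV N a)
  have hJ : ∀ j, (a ᵥ* skelJacAt ω₂ 0 0 γ N T_L T_R s m 0 0 0) j =
      dualPair (ofCoordV N a) (pinnedChainVariation hω le_rfl le_rfl hγ.le N 0
        (continuous_chainNoise_rem ω₂ 0 0 γ N T_L T_R 0)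
        (skelForcing N m (ampL ω₂ 0 0 γ T_L) (ampR ω₂ 0 0 γ T_R)) 0 (basisX m j) s) := by
    intro j
    rw [← fderiv_skelFlowMapAt_apply hω le_rfl le_rfl hγ.le N T_L T_R ⟨hs0.le, hs1⟩ m 0 0 0
      (basisX m j)]
    have h1 := vecMul_skelJacAt_apply (ω₂ := ω₂) (lam := 0) (β := 0) (γ := γ) (T_L := T_L)
      (T_R := T_R) (s := s) (ofCoordV N a) 0 0 0 j
    rwa [coordV_ofCoordV] at h1
  simp_rw [hJ]
  rw [Fintype.sum_sum_type]
  refine h.trans (mul_le_mul_of_nonneg_left (le_add_of_nonneg_right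
    (Finset.sum_nonneg fun k _ => sq_nonneg _)) (by positivity))

/-- **Right bath**: the same with the `inr`-cells and the momentum `N − 1`. [folklore] -/
theorem harmonic_gramForm_ge_right (hN : 2 ≤ N) {s : ℝ} (hs0 : 0 < s) (hs1 : s ≤ 1) (m : ℕ)
    (a : Fin N ⊕ Fin N → ℝ) :
    ampR ω₂ 0 0 γ T_R ^ 2 * ((1 / 2) * (∫ t in (0 : ℝ)..s,
        ((harmCostate ω₂ γ N s (ofCoordV N a) t).2 (rightBath N hN)) ^ 2) -
          ((2 : ℝ) ^ m)⁻¹ * harmGramErr ω₂ γ N s (ofCoordV N a)) ≤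
      ((2 : ℝ) ^ m)⁻¹ * ∑ j, ((a ᵥ* skelJacAt ω₂ 0 0 γ N T_L T_R s m 0 0 0) j) ^ 2 := by
  have hN' : 0 < N := by omega
  have h := harmonic_skelGramForm_ge_inr hω hγ.le hN' T_L T_R m 0 0 0 hs0 hs1 (ofCoordV N a)
  have hJ : ∀ j, (a ᵥ* skelJacAt ω₂ 0 0 γ N T_L T_R s m 0 0 0) j =
      dualPair (ofCoordV N a) (pinnedChainVariation hω le_rfl le_rfl hγ.le N 0
        (continuous_chainNoise_rem ω₂ 0 0 γ N T_L T_R 0)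
        (skelForcing N m (ampL ω₂ 0 0 γ T_L) (ampR ω₂ 0 0 γ T_R)) 0 (basisX m j) s) := by
    intro j
    rw [← fderiv_skelFlowMapAt_apply hω le_rfl le_rfl hγ.le N T_L T_R ⟨hs0.le, hs1⟩ m 0 0 0
      (basisX m j)]
    have h1 := vecMul_skelJacAt_apply (ω₂ := ω₂) (lam := 0) (β := 0) (γ := γ) (T_L := T_L)
      (T_R := T_R) (s := s) (ofCoordV N a) 0 0 0 j
    rwa [coordV_ofCoordV] at h1
  simp_rw [hJ]
  rw [Fintype.sum_sum_type]
  refine h.trans (mul_le_mul_of_nonneg_left (le_add_of_nonneg_left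
    (Finset.sum_nonneg fun k _ => sq_nonneg _)) (by positivity))

omit hω hγ in
/-- **The Gram form of a regularised control is `≤ 4K/(amp² s)`** for `m ≥ m₁(κ)`: the abstract
step combining the sampling lower bound (`hlow`), the pivot rate (`hpiv`) and `pivot_bound`.
[folklore] -/
theorem harmonic_gramForm_le {s : ℝ} (hs0 : 0 < s) (hs1 : s ≤ 1) (m : ℕ) {κ : ℝ} (hκ : 0 < κ)
    (b : Fin N) {amp K : ℝ} (hamp : 0 < amp) (hK : 0 < K) (t : Fin N ⊕ Fin N → ℝ)
    (hlow : ∀ a : Fin N ⊕ Fin N → ℝ,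
      amp ^ 2 * ((1 / 2) * (∫ u in (0 : ℝ)..s, ((harmCostate ω₂ γ N s (ofCoordV N a) u).2 b) ^ 2) -
          ((2 : ℝ) ^ m)⁻¹ * harmGramErr ω₂ γ N s (ofCoordV N a)) ≤
        ((2 : ℝ) ^ m)⁻¹ * ∑ j, ((a ᵥ* skelJacAt ω₂ 0 0 γ N T_L T_R s m 0 0 0) j) ^ 2)
    (hpiv : ∀ a : Fin N ⊕ Fin N → ℝ,
      (a ⬝ᵥ t) ^ 2 ≤ K / s * ∫ u in (0 : ℝ)..s, ((harmCostate ω₂ γ N s (ofCoordV N a) u).2 b) ^ 2)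
    (hm : amp ^ 2 * (((2 : ℝ) ^ m)⁻¹ * (Real.exp ‖harmCoDriftLin ω₂ γ N‖ ^ 2 *
      (1 + ‖harmCoDriftLin ω₂ γ N‖ ^ 2))) ≤ κ) :
    ((2 : ℝ) ^ m)⁻¹ * ∑ j, (((regInv (skelGramAt ω₂ 0 0 γ N T_L T_R s m 0 0 0) κ *ᵥ t) ᵥ*
        skelJacAt ω₂ 0 0 γ N T_L T_R s m 0 0 0) j) ^ 2 ≤ 4 * K / (amp ^ 2 * s) := by
  set a := regInv (skelGramAt ω₂ 0 0 γ N T_L T_R s m 0 0 0) κ *ᵥ t with ha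
  have hQ := gramForm_ctrl_eq (ω₂ := ω₂) (lam := 0) (β := 0) (γ := γ) (T_L := T_L) (T_R := T_R)
    (s := s) (m := m) hκ 0 0 0 t
  rw [← ha] at hQ
  refine pivot_bound (P := a ⬝ᵥ t) (A := a ⬝ᵥ a)
    (I := ∫ u in (0 : ℝ)..s, ((harmCostate ω₂ γ N s (ofCoordV N a) u).2 b) ^ 2)
    (E := harmGramErr ω₂ γ N s (ofCoordV N a))
    (c := Real.exp ‖harmCoDriftLin ω₂ γ N‖ ^ 2 * (1 + ‖harmCoDriftLin ω₂ γ N‖ ^ 2))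
    (v := ((2 : ℝ) ^ m)⁻¹) hκ hs0 hK (by positivity) (by positivity) hQ (by positivity)
    (Finset.sum_nonneg fun i _ => mul_self_nonneg _) (hlow a) (hpiv a) ?_ hm
  exact (harmGramErr_le ω₂ γ N hs1 _).trans
    (mul_le_mul_of_nonneg_left (norm_ofCoordV_sq_le_dotProduct a) (by positivity))

/-- **Arrival**: `2^{-m} Σ_j U_j² ≤ 4K/(2γT_b s)` for the arrival field at a bath site `b`,
`m ≥ m₁(κ)`. [folklore] -/
theorem harmonic_fieldArr_form_le (hN : 2 ≤ N) (hTL : 0 < T_L) (hTR : 0 < T_R) {s : ℝ}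
    (hs0 : 0 < s) (hs1 : s ≤ 1) (m : ℕ) {κ : ℝ} (hκ : 0 < κ) (b : Fin N)
    (hb : b = leftBath N hN ∨ b = rightBath N hN) {K : ℝ} (hK : 0 < K)
    (hrate : ∀ l : PhaseSpace N,
      (l.2 b) ^ 2 ≤ K / s * ∫ t in (0 : ℝ)..s, ((harmCostate ω₂ γ N s l t).2 b) ^ 2)
    (hm : (2 * γ * max T_L T_R) * (((2 : ℝ) ^ m)⁻¹ * (Real.exp ‖harmCoDriftLin ω₂ γ N‖ ^ 2 *
      (1 + ‖harmCoDriftLin ω₂ γ N‖ ^ 2))) ≤ κ) :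
    ((2 : ℝ) ^ m)⁻¹ * ∑ j, (skelFieldArr ω₂ 0 0 γ N T_L T_R s m κ b 0 0 0 j) ^ 2 ≤
      4 * K / (2 * γ * min T_L T_R * s) := by
  have hpiv : ∀ a : Fin N ⊕ Fin N → ℝ, (a ⬝ᵥ momCoord N b) ^ 2 ≤
      K / s * ∫ u in (0 : ℝ)..s, ((harmCostate ω₂ γ N s (ofCoordV N a) u).2 b) ^ 2 := by
    intro a
    rw [momCoord, dotProduct_single_one]
    exact hrate (ofCoordV N a)
  have hc0 : 0 ≤ ((2 : ℝ) ^ m)⁻¹ * (Real.exp ‖harmCoDriftLin ω₂ γ N‖ ^ 2 *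
      (1 + ‖harmCoDriftLin ω₂ γ N‖ ^ 2)) := by positivity
  rcases hb with rfl | rfl
  · have hamp2 : ampL ω₂ 0 0 γ T_L ^ 2 = 2 * γ * T_L := ampL_sq ω₂ 0 0 hγ.le hTL.le
    have hamp : 0 < ampL ω₂ 0 0 γ T_L :=
      Real.sqrt_pos.2 (by rw [show (pinnedChain ω₂ 0 0 γ).γ = γ from rfl]; positivity)
    have h := harmonic_gramForm_le N T_L T_R hs0 hs1 m hκ (leftBath N hN) hamp hK
      (momCoord N (leftBath N hN)) (harmonic_gramForm_ge_left hω hγ N T_L T_R hN hs0 hs1 m) hpiv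
      (by rw [hamp2]
          exact (mul_le_mul_of_nonneg_right
            (mul_le_mul_of_nonneg_left (le_max_left _ _) (by positivity)) hc0).trans hm)
    refine h.trans ?_
    rw [hamp2]
    exact div_le_div_of_nonneg_left (by positivity) (by positivity)
      (mul_le_mul_of_nonneg_right (mul_le_mul_of_nonneg_left (min_le_left _ _) (by positivity))
        hs0.le)
  · have hamp2 : ampR ω₂ 0 0 γ T_R ^ 2 = 2 * γ * T_R := ampR_sq ω₂ 0 0 hγ.le hTR.le
    have hamp : 0 < ampR ω₂ 0 0 γ T_R :=
      Real.sqrt_pos.2 (by rw [show (pinnedChain ω₂ 0 0 γ).γ = γ from rfl]; positivity)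
    have h := harmonic_gramForm_le N T_L T_R hs0 hs1 m hκ (rightBath N hN) hamp hK
      (momCoord N (rightBath N hN)) (harmonic_gramForm_ge_right hω hγ N T_L T_R hN hs0 hs1 m) hpiv
      (by rw [hamp2]
          exact (mul_le_mul_of_nonneg_right
            (mul_le_mul_of_nonneg_left (le_max_right _ _) (by positivity)) hc0).trans hm)
    refine h.trans ?_
    rw [hamp2]
    exact div_le_div_of_nonneg_left (by positivity) (by positivity)
      (mul_le_mul_of_nonneg_right (mul_le_mul_of_nonneg_left (min_le_right _ _) (by positivity))
        hs0.le)

/-- **Departure**: the same for the departure field (pivot `β_λ(0) = a · V`,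
`V = e^{s𝒜}(0, e_b)`). [folklore] -/
theorem harmonic_fieldDep_form_le (hN : 2 ≤ N) (hTL : 0 < T_L) (hTR : 0 < T_R) {s : ℝ}
    (hs0 : 0 < s) (hs1 : s ≤ 1) (m : ℕ) {κ : ℝ} (hκ : 0 < κ) (b : Fin N)
    (hb : b = leftBath N hN ∨ b = rightBath N hN) {K : ℝ} (hK : 0 < K)
    (hrate : ∀ l : PhaseSpace N, ((harmCostate ω₂ γ N s l 0).2 b) ^ 2 ≤
      K / s * ∫ t in (0 : ℝ)..s, ((harmCostate ω₂ γ N s l t).2 b) ^ 2)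
    (hm : (2 * γ * max T_L T_R) * (((2 : ℝ) ^ m)⁻¹ * (Real.exp ‖harmCoDriftLin ω₂ γ N‖ ^ 2 *
      (1 + ‖harmCoDriftLin ω₂ γ N‖ ^ 2))) ≤ κ) :
    ((2 : ℝ) ^ m)⁻¹ * ∑ j, (skelFieldDep ω₂ 0 0 γ N T_L T_R s m κ b 0 0 0 j) ^ 2 ≤
      4 * K / (2 * γ * min T_L T_R * s) := by
  have hpiv : ∀ a : Fin N ⊕ Fin N → ℝ, (a ⬝ᵥ skelDepVec ω₂ 0 0 γ N T_L T_R s m b 0 0 0) ^ 2 ≤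
      K / s * ∫ u in (0 : ℝ)..s, ((harmCostate ω₂ γ N s (ofCoordV N a) u).2 b) ^ 2 := by
    intro a
    have hV : a ⬝ᵥ skelDepVec ω₂ 0 0 γ N T_L T_R s m b 0 0 0 =
        (harmCostate ω₂ γ N s (ofCoordV N a) 0).2 b := by
      rw [harmonic_skelDepVec_eq hω hγ N T_L T_R ⟨hs0.le, hs1⟩ m b 0 0 0]
      have h1 := dualPair_eq_dotProduct (N := N) (c := ofCoordV N a)
        (v := exp (s • harmDriftLin ω₂ γ N) (((0 : Fin N → ℝ), Pi.single b 1) : PhaseSpace N))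
      rw [coordV_ofCoordV] at h1
      rw [← h1, dualPair_exp_harmDriftLin, dualPair_zero_mk]
      simp [Pi.single_apply]
    rw [hV]
    exact hrate (ofCoordV N a)
  have hc0 : 0 ≤ ((2 : ℝ) ^ m)⁻¹ * (Real.exp ‖harmCoDriftLin ω₂ γ N‖ ^ 2 *
      (1 + ‖harmCoDriftLin ω₂ γ N‖ ^ 2)) := by positivity
  have hdef : ∀ j, skelFieldDep ω₂ 0 0 γ N T_L T_R s m κ b 0 0 0 j =
      ((regInv (skelGramAt ω₂ 0 0 γ N T_L T_R s m 0 0 0) κ *ᵥ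
        skelDepVec ω₂ 0 0 γ N T_L T_R s m b 0 0 0) ᵥ* skelJacAt ω₂ 0 0 γ N T_L T_R s m 0 0 0) j :=
    fun j => rfl
  simp_rw [hdef]
  rcases hb with rfl | rfl
  · have hamp2 : ampL ω₂ 0 0 γ T_L ^ 2 = 2 * γ * T_L := ampL_sq ω₂ 0 0 hγ.le hTL.le
    have hamp : 0 < ampL ω₂ 0 0 γ T_L :=
      Real.sqrt_pos.2 (by rw [show (pinnedChain ω₂ 0 0 γ).γ = γ from rfl]; positivity)
    have h := harmonic_gramForm_le N T_L T_R hs0 hs1 m hκ (leftBath N hN) hamp hK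
      (skelDepVec ω₂ 0 0 γ N T_L T_R s m (leftBath N hN) 0 0 0)
      (harmonic_gramForm_ge_left hω hγ N T_L T_R hN hs0 hs1 m) hpiv
      (by rw [hamp2]
          exact (mul_le_mul_of_nonneg_right
            (mul_le_mul_of_nonneg_left (le_max_left _ _) (by positivity)) hc0).trans hm)
    refine h.trans ?_
    rw [hamp2]
    exact div_le_div_of_nonneg_left (by positivity) (by positivity)
      (mul_le_mul_of_nonneg_right (mul_le_mul_of_nonneg_left (min_le_left _ _) (by positivity))
        hs0.le)
  · have hamp2 : ampR ω₂ 0 0 γ T_R ^ 2 = 2 * γ * T_R := ampR_sq ω₂ 0 0 hγ.le hTR.le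
    have hamp : 0 < ampR ω₂ 0 0 γ T_R :=
      Real.sqrt_pos.2 (by rw [show (pinnedChain ω₂ 0 0 γ).γ = γ from rfl]; positivity)
    have h := harmonic_gramForm_le N T_L T_R hs0 hs1 m hκ (rightBath N hN) hamp hK
      (skelDepVec ω₂ 0 0 γ N T_L T_R s m (rightBath N hN) 0 0 0)
      (harmonic_gramForm_ge_right hω hγ N T_L T_R hN hs0 hs1 m) hpiv
      (by rw [hamp2]
          exact (mul_le_mul_of_nonneg_right
            (mul_le_mul_of_nonneg_left (le_max_right _ _) (by positivity)) hc0).trans hm)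
    refine h.trans ?_
    rw [hamp2]
    exact div_le_div_of_nonneg_left (by positivity) (by positivity)
      (mul_le_mul_of_nonneg_right (mul_le_mul_of_nonneg_left (min_le_right _ _) (by positivity))
        hs0.le)

end Harmonic

/-! ## 4. The calibration theorem -/

section Calibration

/-- The body of (SWM) at fixed chain parameters (verbatim from part R). [folklore] -/
def SWMBody (ω₂ lam β γ : ℝ) : Prop :=
    ∀ T : ℝ, 0 < T → ∀ (N : ℕ) (hN : 2 ≤ N), ∀ q ε : ℝ, 2 ≤ q → 0 < ε →
      ∃ C b₀ δ₀ : ℝ, b₀ < 1 ∧ 0 < δ₀ ∧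
        (∀ δ : ℝ, |δ| < δ₀ → ∀ s : ℝ, 0 < s → s ≤ 1 →
          ∀ b : Fin N, (b = leftBath N hN ∨ b = rightBath N hN) → ∀ z : PhaseSpace N,
            ∀ κ : ℝ, 0 < κ → ∃ m₁ : ℕ, ∀ m : ℕ, m₁ ≤ m →
              skelMoment m q (skelWeightArr ω₂ lam β γ N (T + δ / 2) (T - δ / 2) s m κ b z) ≤
                ENNReal.ofReal ((C * s ^ (-b₀) *
                  Real.exp (ε * (pinnedChain ω₂ lam β γ).hamiltonian N z)) ^ q)) ∧
        (∀ s : ℝ, 0 < s → s ≤ 1 →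
          ∀ b : Fin N, (b = leftBath N hN ∨ b = rightBath N hN) → ∀ z : PhaseSpace N,
            ∀ κ : ℝ, 0 < κ → ∃ m₁ : ℕ, ∀ m : ℕ, m₁ ≤ m →
              skelMoment m q (skelWeightDep ω₂ lam β γ N T T s m κ b z) ≤
                ENNReal.ofReal ((C * s ^ (-b₀) *
                  Real.exp (ε * (pinnedChain ω₂ lam β γ).hamiltonian N z)) ^ q))

/-- **(SWM) is, by definition, `SWMBody` at all positive parameters** (`Iff.rfl`: the shape used
below IS the shape of part R). [folklore] -/
theorem skeletonWeightMoments_iff :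
    SkeletonWeightMoments ↔
      ∀ ω₂ lam β γ : ℝ, 0 < ω₂ → 0 < lam → 0 < β → 0 < γ → SWMBody ω₂ lam β γ :=
  Iff.rfl

/-- **HARMONIC CALIBRATION, rate form.**  For the harmonic chain (`lam = β = 0`), every `q > 0`,
`T > 0`, `N ≥ 2`: there is `C` with `‖w_{m,κ}‖_{L^q} ≤ C s^{-1/2}` for the regularised arrival
weights of the chain with baths `T ± δ/2`, `|δ| < T`, and for the regularised departure weights of
the equal-temperature chain — all `0 < s ≤ 1`, both bath sites, all `z`, every `κ > 0`, eventually
in the level `m ≥ m₁(κ)`.  The exponent `b₀ = 1/2` is the (SWM) calibration. [folklore] -/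
theorem harmonicSkeletonWeightMoments {ω₂ γ : ℝ} (hω : 0 < ω₂) (hγ : 0 < γ) {T : ℝ} (hT : 0 < T)
    (N : ℕ) (hN : 2 ≤ N) {q : ℝ} (hq : 0 < q) :
    ∃ C : ℝ, 0 ≤ C ∧
      (∀ δ : ℝ, |δ| < T → ∀ s : ℝ, 0 < s → s ≤ 1 →
        ∀ b : Fin N, (b = leftBath N hN ∨ b = rightBath N hN) → ∀ z : PhaseSpace N,
          ∀ κ : ℝ, 0 < κ → ∃ m₁ : ℕ, ∀ m : ℕ, m₁ ≤ m →
            skelMoment m q (skelWeightArr ω₂ 0 0 γ N (T + δ / 2) (T - δ / 2) s m κ b z) ≤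
              ENNReal.ofReal ((C * s ^ (-(1 / 2 : ℝ))) ^ q)) ∧
      (∀ s : ℝ, 0 < s → s ≤ 1 →
        ∀ b : Fin N, (b = leftBath N hN ∨ b = rightBath N hN) → ∀ z : PhaseSpace N,
          ∀ κ : ℝ, 0 < κ → ∃ m₁ : ℕ, ∀ m : ℕ, m₁ ≤ m →
            skelMoment m q (skelWeightDep ω₂ 0 0 γ N T T s m κ b z) ≤
              ENNReal.ofReal ((C * s ^ (-(1 / 2 : ℝ))) ^ q)) := by
  -- the rate constants of the two bath sites
  obtain ⟨KL, hKL, hL⟩ := harmonic_pivot_rate ω₂ γ N (leftBath N hN)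
  obtain ⟨KR, hKR, hR⟩ := harmonic_pivot_rate ω₂ γ N (rightBath N hN)
  set K := KL + KR with hK_def
  have hK : 0 < K := by positivity
  have hKb : ∀ b : Fin N, (b = leftBath N hN ∨ b = rightBath N hN) → ∀ s : ℝ, 0 < s → s ≤ 1 →
      ∀ l : PhaseSpace N,
        (l.2 b) ^ 2 ≤ K / s * ∫ t in (0 : ℝ)..s, ((harmCostate ω₂ γ N s l t).2 b) ^ 2 ∧
        ((harmCostate ω₂ γ N s l 0).2 b) ^ 2 ≤
          K / s * ∫ t in (0 : ℝ)..s, ((harmCostate ω₂ γ N s l t).2 b) ^ 2 := by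
    intro b hb s hs hs1 l
    have hI0 : 0 ≤ ∫ t in (0 : ℝ)..s, ((harmCostate ω₂ γ N s l t).2 b) ^ 2 :=
      intervalIntegral.integral_nonneg hs.le fun t _ => sq_nonneg _
    rcases hb with rfl | rfl
    · have h := hL s hs hs1 l
      have hk : KL / s ≤ K / s := div_le_div_of_nonneg_right (by linarith) hs.le
      exact ⟨h.1.trans (mul_le_mul_of_nonneg_right hk hI0),
        h.2.trans (mul_le_mul_of_nonneg_right hk hI0)⟩
    · have h := hR s hs hs1 l
      have hk : KR / s ≤ K / s := div_le_div_of_nonneg_right (by linarith) hs.le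
      exact ⟨h.1.trans (mul_le_mul_of_nonneg_right hk hI0),
        h.2.trans (mul_le_mul_of_nonneg_right hk hI0)⟩
  -- the constant
  set c₁ : ℝ := 4 * K / (γ * T) with hc₁
  have hc₁0 : 0 ≤ c₁ := by positivity
  refine ⟨(gaussAbsMoment q).toReal ^ q⁻¹ * Real.sqrt c₁,
    mul_nonneg (Real.rpow_nonneg ENNReal.toReal_nonneg _) (Real.sqrt_nonneg _), ?_, ?_⟩
  · intro δ hδ s hs0 hs1 b hb z κ hκ
    have hδ' := abs_lt.1 hδ
    have hTL : 0 < T + δ / 2 := by linarith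
    have hTR : 0 < T - δ / 2 := by linarith
    have hmin : γ * T ≤ 2 * γ * min (T + δ / 2) (T - δ / 2) := by
      rw [mul_assoc, mul_left_comm]
      refine mul_le_mul_of_nonneg_left ?_ hγ.le
      rcases min_choice (T + δ / 2) (T - δ / 2) with h | h <;> rw [h] <;> linarith
    obtain ⟨m₁, hm₁⟩ := exists_level_le hκ (C := (2 * γ * max (T + δ / 2) (T - δ / 2)) *
      (Real.exp ‖harmCoDriftLin ω₂ γ N‖ ^ 2 * (1 + ‖harmCoDriftLin ω₂ γ N‖ ^ 2)))
      (by positivity)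
    refine ⟨m₁, fun m hm => ?_⟩
    have hform := harmonic_fieldArr_form_le hω hγ N (T + δ / 2) (T - δ / 2) hN hTL hTR hs0 hs1
      m hκ b hb hK (fun l => (hKb b hb s hs0 hs1 l).1)
      (by have h := hm₁ m hm; linarith [h])
    have hρ : ((2 : ℝ) ^ m)⁻¹ *
        ∑ j, (skelFieldArr ω₂ 0 0 γ N (T + δ / 2) (T - δ / 2) s m κ b 0 0 0 j) ^ 2 ≤ c₁ * s⁻¹ := by
      refine hform.trans ?_
      have h1 : 4 * K / (2 * γ * min (T + δ / 2) (T - δ / 2) * s) ≤ 4 * K / (γ * T * s) :=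
        div_le_div_of_nonneg_left (by positivity) (by positivity)
          (mul_le_mul_of_nonneg_right hmin hs0.le)
      have h2 : c₁ * s⁻¹ = 4 * K / (γ * T * s) := by rw [hc₁, ← div_eq_mul_inv, div_div]
      rw [h2]
      exact h1
    have h := harmonic_skelMoment_arr_le hω hγ N (T + δ / 2) (T - δ / 2) ⟨hs0.le, hs1⟩ m hq κ b z hρ
    rwa [sqrt_mul_inv_eq hc₁0 hs0.le, ← mul_assoc] at h
  · intro s hs0 hs1 b hb z κ hκ
    obtain ⟨m₁, hm₁⟩ := exists_level_le hκ (C := (2 * γ * max T T) *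
      (Real.exp ‖harmCoDriftLin ω₂ γ N‖ ^ 2 * (1 + ‖harmCoDriftLin ω₂ γ N‖ ^ 2)))
      (by positivity)
    refine ⟨m₁, fun m hm => ?_⟩
    have hform := harmonic_fieldDep_form_le hω hγ N T T hN hT hT hs0 hs1 m hκ b hb hK
      (fun l => (hKb b hb s hs0 hs1 l).2) (by have h := hm₁ m hm; linarith [h])
    have hρ : ((2 : ℝ) ^ m)⁻¹ *
        ∑ j, (skelFieldDep ω₂ 0 0 γ N T T s m κ b 0 0 0 j) ^ 2 ≤ c₁ * s⁻¹ := by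
      refine hform.trans ?_
      have hmin : γ * T ≤ 2 * γ * min T T := by rw [min_self]; nlinarith [mul_pos hγ hT]
      have h1 : 4 * K / (2 * γ * min T T * s) ≤ 4 * K / (γ * T * s) :=
        div_le_div_of_nonneg_left (by positivity) (by positivity)
          (mul_le_mul_of_nonneg_right hmin hs0.le)
      have h2 : c₁ * s⁻¹ = 4 * K / (γ * T * s) := by rw [hc₁, ← div_eq_mul_inv, div_div]
      rw [h2]
      exact h1
    have h := harmonic_skelMoment_dep_le hω hγ N T T ⟨hs0.le, hs1⟩ m hq κ b z hρ
    rwa [sqrt_mul_inv_eq hc₁0 hs0.le, ← mul_assoc] at h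

/-- **HARMONIC CALIBRATION of (SWM).**  The harmonic chain (`lam = β = 0`, any `ω₂, γ > 0`)
satisfies the body of (SWM) — verbatim the clause shape of part R — with `b₀ = 1/2` and `δ₀ = T`
(for every `ε > 0`: the energy weight `e^{εH} ≥ 1` is not needed).  This is the witness required
by critic rows 1093 (g) / 1107 (e): (SWM)'s shape is DECIDED on the harmonic chain, and the rate
exponent there is exactly `1/2`. [folklore] -/
theorem harmonic_swmBody {ω₂ γ : ℝ} (hω : 0 < ω₂) (hγ : 0 < γ) : SWMBody ω₂ 0 0 γ := by
  intro T hT N hN q ε hq hε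
  obtain ⟨C, hC0, hA, hD⟩ := harmonicSkeletonWeightMoments hω hγ hT N hN (by linarith : 0 < q)
  have hmono : ∀ s : ℝ, 0 < s → ∀ z : PhaseSpace N,
      ENNReal.ofReal ((C * s ^ (-(1 / 2 : ℝ))) ^ q) ≤
        ENNReal.ofReal ((C * s ^ (-(1 / 2 : ℝ)) *
          Real.exp (ε * (pinnedChain ω₂ 0 0 γ).hamiltonian N z)) ^ q) := by
    intro s hs z
    have hx : 0 ≤ C * s ^ (-(1 / 2 : ℝ)) := mul_nonneg hC0 (Real.rpow_nonneg hs.le _)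
    refine ENNReal.ofReal_le_ofReal (Real.rpow_le_rpow hx (le_mul_of_one_le_right hx
      (Real.one_le_exp (mul_nonneg hε.le
        (pinnedChain_hamiltonian_nonneg hω.le le_rfl le_rfl γ N z)))) (by linarith))
  refine ⟨C, 1 / 2, T, by norm_num, hT, ?_, ?_⟩
  · intro δ hδ s hs0 hs1 b hb z κ hκ
    obtain ⟨m₁, hm₁⟩ := hA δ hδ s hs0 hs1 b hb z κ hκ
    exact ⟨m₁, fun m hm => (hm₁ m hm).trans (hmono s hs0 z)⟩
  · intro s hs0 hs1 b hb z κ hκ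
    obtain ⟨m₁, hm₁⟩ := hD s hs0 hs1 b hb z κ hκ
    exact ⟨m₁, fun m hm => (hm₁ m hm).trans (hmono s hs0 z)⟩

end Calibration

end Summit.AtomisticToContinuum.FouriersLaw.Theorems.ExtensiveSnapshotIrreversibility.EnergyWindow
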